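/-
Copyright (c) 2026. All rights reserved.
Released under Apache 2.0 license as described in the file LICENSE.
-/
import Summits.AtomisticToContinuum.Crystallization.Theorems.ChartedZeroExcessLayeredLatticeLiouvilleVX

/-!
# ChartedZeroExcessLayeredLatticeLiouville — part VY «FluxEnergy»: the column fluxes through the INNER gaps of a layer range are controlled by the
  vertical increments INSIDE the range, a decaying RIM term and the slope — uniformly in the truncation range `ϱ`
  (decomp-a2c-lens-2, g58; second part of brick (4b) MODE RIGIDITY of stmt-AtomisticToContinuum-26636, leaf (LD′) `ModalLipschitzZ`)

For a mode field `(g, cf)` with increments `Δ k = cf (k+1) − cf k` bounded by `D`, and layer ranges `J = [α₀ − R, α₀ + R − 1]` (inside) and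
`J' = [α₀ − R', α₀ + R' − 1]` (inner gaps, `R' ≤ R`):
* VY.1 the band weights `bandWt m k = (|m − k| + 1)⁻⁴` (VR `norm_fluxBlock_le_decay`): row/column sums `≤ 3` (VS), far sums `≤ 3·(s+1)⁻²`;
* VY.2 `norm_columnFlux_le_split` — per gap `m`: `‖columnFlux m‖ ≤ 196F₀·Σ_{k ∈ J} bandWt m k ‖Δ k‖ + 196F₀·D·Σ_{k ∈ band ∖ J} bandWt m k + 441F₀‖g‖₁`
  (VP/VT flux representation `columnFlux_eq_sum_fluxBlock_add`), its square with Cauchy–Schwarz in the weights (`norm_columnFlux_sq_le`);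
* VY.3 ★ `flux_sq_sum_le` — summed over the inner gaps: `Σ_{m ∈ J'} ‖columnFlux m‖² ≤ 27·(196F₀)²·Σ_{k ∈ J} ‖Δ k‖² + 2R'·(3·(196F₀·D·3(R−R'+1)⁻²)² +
  3·(441F₀‖g‖₁)²)` — no harmonicity is used; part VZ feeds in flux conservation, the energy lower bounds and VX's increment bound.
-/

namespace Summit.AtomisticToContinuum.Crystallization.Theorems.ChartedZeroExcessLayeredLatticeLiouville

open Summit.AtomisticToContinuum.Crystallization.Theorems.ChartedPlanarOrderRigidityDoor (E3)
open Finset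
open scoped InnerProductSpace RealInnerProductSpace BigOperators

noncomputable section FluxEnergy

variable {c : ℝ} {a b : E3} {w : ℤ → E3}

/-! ### VY.1  Band weights -/

/-- the BAND WEIGHT `(|m − k| + 1)⁻⁴` of VR's flux-block decay `‖fluxBlock m k‖ ≤ 196·kernelConst·bandWt m k`. [this file, g58] -/
def bandWt (m k : ℤ) : ℝ := (((((m - k).natAbs : ℕ) : ℝ) + 1)⁻¹) ^ 4

/-- band weights are non-negative. [formal bookkeeping] -/
theorem bandWt_nonneg (m k : ℤ) : 0 ≤ bandWt m k := by
  unfold bandWt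
  positivity

/-- `(|m−k|+1)⁻⁴ ≤ (|m−k|+1)⁻²`. [formal bookkeeping] -/
theorem bandWt_le_sq (m k : ℤ) : bandWt m k ≤ (((((m - k).natAbs : ℕ) : ℝ) + 1)⁻¹) ^ 2 := by
  unfold bandWt
  have h1 : (1 : ℝ) ≤ (((m - k).natAbs : ℕ) : ℝ) + 1 := by
    have : (0 : ℝ) ≤ (((m - k).natAbs : ℕ) : ℝ) := Nat.cast_nonneg _
    linarith
  exact pow_le_pow_of_le_one (by positivity) (inv_le_one_of_one_le₀ h1) (by norm_num)

/-- FAR weights: if `s ≤ |m − k|` then `bandWt m k ≤ (|m−k|+1)⁻² · (s+1)⁻²`. [formal bookkeeping] -/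
theorem bandWt_le_far {m k : ℤ} {s : ℕ} (hs : s ≤ (m - k).natAbs) :
    bandWt m k ≤ (((((m - k).natAbs : ℕ) : ℝ) + 1)⁻¹) ^ 2 * ((((s : ℕ) : ℝ) + 1)⁻¹) ^ 2 := by
  unfold bandWt
  have hs' : ((s : ℕ) : ℝ) + 1 ≤ (((m - k).natAbs : ℕ) : ℝ) + 1 := by
    have : ((s : ℕ) : ℝ) ≤ (((m - k).natAbs : ℕ) : ℝ) := by exact_mod_cast hs
    linarith
  have h0 : (0 : ℝ) < ((s : ℕ) : ℝ) + 1 := by positivity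
  have hle : ((((m - k).natAbs : ℕ) : ℝ) + 1)⁻¹ ≤ (((s : ℕ) : ℝ) + 1)⁻¹ := inv_anti₀ h0 hs'
  have hnn : (0 : ℝ) ≤ ((((m - k).natAbs : ℕ) : ℝ) + 1)⁻¹ := by positivity
  calc (((((m - k).natAbs : ℕ) : ℝ) + 1)⁻¹) ^ 4 = (((((m - k).natAbs : ℕ) : ℝ) + 1)⁻¹) ^ 2 * (((((m - k).natAbs : ℕ) : ℝ) + 1)⁻¹) ^ 2 := by ring
    _ ≤ (((((m - k).natAbs : ℕ) : ℝ) + 1)⁻¹) ^ 2 * ((((s : ℕ) : ℝ) + 1)⁻¹) ^ 2 :=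
        mul_le_mul_of_nonneg_left (pow_le_pow_left₀ hnn hle 2) (by positivity)

/-- ROW SUM of the band weights: `Σ_{k ∈ P} bandWt m k ≤ 3` (VS `sum_inv_sq_natAbs_succ_le`). [formal bookkeeping] -/
theorem sum_bandWt_le (P : Finset ℤ) (m : ℤ) : ∑ k ∈ P, bandWt m k ≤ 3 :=
  (sum_le_sum fun k _ => bandWt_le_sq m k).trans (sum_inv_sq_natAbs_succ_le P m)

/-- COLUMN SUM of the band weights: `Σ_{m ∈ P} bandWt m k ≤ 3` (VS `sum_inv_sq_natAbs_succ_le'`). [formal bookkeeping] -/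
theorem sum_bandWt_le' (P : Finset ℤ) (k : ℤ) : ∑ m ∈ P, bandWt m k ≤ 3 :=
  (sum_le_sum fun m _ => bandWt_le_sq m k).trans (sum_inv_sq_natAbs_succ_le' P k)

/-- FAR ROW SUM: over sites at distance `≥ s`, `Σ bandWt m k ≤ 3·(s+1)⁻²`. [formal bookkeeping] -/
theorem sum_bandWt_le_far (P : Finset ℤ) (m : ℤ) {s : ℕ} (hs : ∀ k ∈ P, s ≤ (m - k).natAbs) :
    ∑ k ∈ P, bandWt m k ≤ 3 * ((((s : ℕ) : ℝ) + 1)⁻¹) ^ 2 := by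
  calc ∑ k ∈ P, bandWt m k ≤ ∑ k ∈ P, (((((m - k).natAbs : ℕ) : ℝ) + 1)⁻¹) ^ 2 * ((((s : ℕ) : ℝ) + 1)⁻¹) ^ 2 :=
        sum_le_sum fun k hk => bandWt_le_far (hs k hk)
    _ = (∑ k ∈ P, (((((m - k).natAbs : ℕ) : ℝ) + 1)⁻¹) ^ 2) * ((((s : ℕ) : ℝ) + 1)⁻¹) ^ 2 := by rw [sum_mul]
    _ ≤ 3 * ((((s : ℕ) : ℝ) + 1)⁻¹) ^ 2 := mul_le_mul_of_nonneg_right (sum_inv_sq_natAbs_succ_le P m) (by positivity)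

/-! ### VY.2  The column flux through one gap: inside increments, rim, slope -/

/-- the column flux of the mode field `(g, cf)` = banded flux-block sum of the increments + box slope flux (VT `columnFlux_eq`, VP `chainFlux_eq_box`,
`chainFlux_eq_sum_fluxBlock`). [formal bookkeeping] -/
theorem columnFlux_eq_sum_fluxBlock_add (hc : 0 < c) (hL : IsLayeredCrystal c a b w) (ϱ : ℝ) (g : Fin 2 → E3) (cf : ℤ → E3) (m : ℤ) :
    columnFlux ϱ a b w ⌊ϱ / c⌋₊ g cf m =
      (∑ k ∈ Icc (m - ⌊ϱ / c⌋₊) (m + ⌊ϱ / c⌋₊), fluxBlock hc hL ϱ m k (cf (k + 1) - cf k)) + boxSlope ϱ a b w ⌊ϱ / c⌋₊ g m := by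
  rw [columnFlux_eq, ← chainFlux_eq_box hc hL cf (Subset.refl _), chainFlux_eq_sum_fluxBlock hc hL cf (Subset.refl _)]

/-- ★ PER-GAP FLUX BOUND, split along a layer set `J`: `‖columnFlux m‖ ≤ 196F₀·Σ_{k ∈ J} bandWt m k·‖Δ k‖ + 196F₀·D·Σ_{k ∈ band ∖ J} bandWt m k +
441F₀·‖g‖₁` for increments bounded by `D` (VR `norm_fluxBlock_le_decay`, VU `norm_boxSlope_le`). [this file, g58] -/
theorem norm_columnFlux_le_split (hc : 0 < c) (hL : IsLayeredCrystal c a b w) (ϱ : ℝ) (g : Fin 2 → E3) (cf : ℤ → E3) (m : ℤ)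
    (J : Finset ℤ) {D : ℝ} (hD : ∀ k : ℤ, ‖cf (k + 1) - cf k‖ ≤ D) :
    ‖columnFlux ϱ a b w ⌊ϱ / c⌋₊ g cf m‖ ≤
      196 * kernelConst c * (∑ k ∈ J, bandWt m k * ‖cf (k + 1) - cf k‖) +
        196 * kernelConst c * D * (∑ k ∈ Icc (m - ⌊ϱ / c⌋₊) (m + ⌊ϱ / c⌋₊) with k ∉ J, bandWt m k) +
        441 * kernelConst c * (‖g 0‖ + ‖g 1‖) := by
  have hF := kernelConst_nonneg hc
  have h196 : (0 : ℝ) ≤ 196 * kernelConst c := by positivity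
  rw [columnFlux_eq_sum_fluxBlock_add hc hL ϱ g cf m]
  refine (norm_add_le _ _).trans (add_le_add ?_ (norm_boxSlope_le hc hL ϱ _ g m))
  refine (norm_sum_le _ _).trans ?_
  have hterm : ∀ k : ℤ, ‖fluxBlock hc hL ϱ m k (cf (k + 1) - cf k)‖ ≤ 196 * kernelConst c * (bandWt m k * ‖cf (k + 1) - cf k‖) := fun k => by
    refine ((fluxBlock hc hL ϱ m k).le_opNorm _).trans ?_
    rw [← mul_assoc]
    exact mul_le_mul_of_nonneg_right (norm_fluxBlock_le_decay hc hL ϱ m k) (norm_nonneg _)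
  rw [← sum_filter_add_sum_filter_not (Icc (m - (⌊ϱ / c⌋₊ : ℤ)) (m + ⌊ϱ / c⌋₊)) (fun k => k ∈ J)]
  refine add_le_add ?_ ?_
  · calc ∑ k ∈ Icc (m - (⌊ϱ / c⌋₊ : ℤ)) (m + ⌊ϱ / c⌋₊) with k ∈ J, ‖fluxBlock hc hL ϱ m k (cf (k + 1) - cf k)‖
        ≤ ∑ k ∈ Icc (m - (⌊ϱ / c⌋₊ : ℤ)) (m + ⌊ϱ / c⌋₊) with k ∈ J, 196 * kernelConst c * (bandWt m k * ‖cf (k + 1) - cf k‖) :=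
          sum_le_sum fun k _ => hterm k
      _ ≤ ∑ k ∈ J, 196 * kernelConst c * (bandWt m k * ‖cf (k + 1) - cf k‖) :=
          sum_le_sum_of_subset_of_nonneg (fun k hk => (mem_filter.mp hk).2)
            fun k _ _ => mul_nonneg h196 (mul_nonneg (bandWt_nonneg m k) (norm_nonneg _))
      _ = 196 * kernelConst c * ∑ k ∈ J, bandWt m k * ‖cf (k + 1) - cf k‖ := by rw [mul_sum]
  · calc ∑ k ∈ Icc (m - (⌊ϱ / c⌋₊ : ℤ)) (m + ⌊ϱ / c⌋₊) with ¬ k ∈ J, ‖fluxBlock hc hL ϱ m k (cf (k + 1) - cf k)‖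
        ≤ ∑ k ∈ Icc (m - (⌊ϱ / c⌋₊ : ℤ)) (m + ⌊ϱ / c⌋₊) with ¬ k ∈ J, 196 * kernelConst c * (bandWt m k * D) :=
          sum_le_sum fun k _ => (hterm k).trans
            (mul_le_mul_of_nonneg_left (mul_le_mul_of_nonneg_left (hD k) (bandWt_nonneg m k)) h196)
      _ = 196 * kernelConst c * D * ∑ k ∈ Icc (m - (⌊ϱ / c⌋₊ : ℤ)) (m + ⌊ϱ / c⌋₊) with ¬ k ∈ J, bandWt m k := by
          rw [mul_sum]
          exact sum_congr rfl fun k _ => by ring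

-- `add_three_sq_le` ((x+y+z)² ≤ 3(x²+y²+z²)) restates Literature `…MatomakiRadziwillL14.sq_add_three_le` (gate dedup.landed at landing, hand-2 g27):
-- copy deleted, inlined at its one use below as a local `have`; statements untouched.

/-- CAUCHY–SCHWARZ in the band weights: `(Σ_{k ∈ J} bandWt m k·x k)² ≤ 3·Σ_{k ∈ J} bandWt m k·x k²`. [formal bookkeeping] -/
theorem sq_sum_bandWt_mul_le (J : Finset ℤ) (m : ℤ) (x : ℤ → ℝ) :
    (∑ k ∈ J, bandWt m k * x k) ^ 2 ≤ 3 * ∑ k ∈ J, bandWt m k * x k ^ 2 := by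
  have hcs := sum_sq_le_sum_mul_sum_of_sq_le_mul J (r := fun k => bandWt m k * x k) (f := fun k => bandWt m k)
    (g := fun k => bandWt m k * x k ^ 2) (fun k _ => bandWt_nonneg m k) (fun k _ => mul_nonneg (bandWt_nonneg m k) (sq_nonneg _))
    (fun k _ => le_of_eq (by ring))
  refine hcs.trans (mul_le_mul_of_nonneg_right (sum_bandWt_le J m) (sum_nonneg fun k _ => mul_nonneg (bandWt_nonneg m k) (sq_nonneg _)))

/-- ★ PER-GAP FLUX BOUND, SQUARED: `‖columnFlux m‖² ≤ 3·(196F₀)²·3·Σ_{k ∈ J} bandWt m k·‖Δ k‖² + 3·(196F₀·D·Σ_{band ∖ J} bandWt m k)² + 3·(441F₀‖g‖₁)²`.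
[this file, g58] -/
theorem norm_columnFlux_sq_le (hc : 0 < c) (hL : IsLayeredCrystal c a b w) (ϱ : ℝ) (g : Fin 2 → E3) (cf : ℤ → E3) (m : ℤ)
    (J : Finset ℤ) {D : ℝ} (hD : ∀ k : ℤ, ‖cf (k + 1) - cf k‖ ≤ D) :
    ‖columnFlux ϱ a b w ⌊ϱ / c⌋₊ g cf m‖ ^ 2 ≤
      3 * ((196 * kernelConst c) ^ 2 * (3 * ∑ k ∈ J, bandWt m k * ‖cf (k + 1) - cf k‖ ^ 2)) +
        3 * (196 * kernelConst c * D * ∑ k ∈ Icc (m - ⌊ϱ / c⌋₊) (m + ⌊ϱ / c⌋₊) with k ∉ J, bandWt m k) ^ 2 +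
        3 * (441 * kernelConst c * (‖g 0‖ + ‖g 1‖)) ^ 2 := by
  have hF := kernelConst_nonneg hc
  have hD0 : 0 ≤ D := (norm_nonneg _).trans (hD 0)
  have hS0 : 0 ≤ ∑ k ∈ J, bandWt m k * ‖cf (k + 1) - cf k‖ := sum_nonneg fun k _ => mul_nonneg (bandWt_nonneg m k) (norm_nonneg _)
  have hW0 : 0 ≤ ∑ k ∈ Icc (m - (⌊ϱ / c⌋₊ : ℤ)) (m + ⌊ϱ / c⌋₊) with k ∉ J, bandWt m k := sum_nonneg fun k _ => bandWt_nonneg m k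
  have hsplit := norm_columnFlux_le_split hc hL ϱ g cf m J hD
  have hrhs0 : 0 ≤ 196 * kernelConst c * (∑ k ∈ J, bandWt m k * ‖cf (k + 1) - cf k‖) +
      196 * kernelConst c * D * (∑ k ∈ Icc (m - (⌊ϱ / c⌋₊ : ℤ)) (m + ⌊ϱ / c⌋₊) with k ∉ J, bandWt m k) +
      441 * kernelConst c * (‖g 0‖ + ‖g 1‖) := by positivity
  have hsq := pow_le_pow_left₀ (norm_nonneg _) hsplit 2
  have add_three_sq_le : ∀ x y z : ℝ, (x + y + z) ^ 2 ≤ 3 * (x ^ 2 + y ^ 2 + z ^ 2) := fun x y z => by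
    nlinarith [sq_nonneg (x - y), sq_nonneg (y - z), sq_nonneg (x - z)]
  refine hsq.trans ((add_three_sq_le _ _ _).trans ?_)
  have hcs := sq_sum_bandWt_mul_le J m (fun k => ‖cf (k + 1) - cf k‖)
  have h1 : (196 * kernelConst c * ∑ k ∈ J, bandWt m k * ‖cf (k + 1) - cf k‖) ^ 2 ≤
      (196 * kernelConst c) ^ 2 * (3 * ∑ k ∈ J, bandWt m k * ‖cf (k + 1) - cf k‖ ^ 2) := by
    rw [mul_pow]
    exact mul_le_mul_of_nonneg_left hcs (sq_nonneg _)
  linarith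

/-! ### VY.3  ★ Summing over the inner gaps -/

/-- FAR RIM: for an inner gap `m ∈ [α₀ − R', α₀ + R' − 1]` and a layer `k` outside `[α₀ − R, α₀ + R − 1]`, `|m − k| ≥ R − R'`. [formal bookkeeping] -/
theorem far_of_inner_gap {α₀ m k : ℤ} {R R' : ℕ} (hm : m ∈ Icc (α₀ - R') (α₀ + R' - 1)) (hk : k ∉ Icc (α₀ - R) (α₀ + R - 1)) :
    R - R' ≤ (m - k).natAbs := by
  rw [mem_Icc] at hm hk
  omega

/-- EXCHANGE: `Σ_{m ∈ P} Σ_{k ∈ J} bandWt m k·x k ≤ 3·Σ_{k ∈ J} x k` for non-negative `x` (column sums `≤ 3`). [formal bookkeeping] -/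
theorem sum_sum_bandWt_mul_le (P J : Finset ℤ) {x : ℤ → ℝ} (hx : ∀ k, 0 ≤ x k) :
    ∑ m ∈ P, ∑ k ∈ J, bandWt m k * x k ≤ 3 * ∑ k ∈ J, x k := by
  rw [sum_comm, mul_sum]
  refine sum_le_sum fun k _ => ?_
  rw [← sum_mul]
  exact mul_le_mul_of_nonneg_right (sum_bandWt_le' P k) (hx k)

/-- ★ THE INNER-GAP FLUX BOUND: for a mode field `(g, cf)` with increments bounded by `D` (of interest for `R' ≤ R`),
`Σ_{m ∈ [α₀−R', α₀+R'−1]} ‖columnFlux m‖² ≤ 27·(196F₀)²·Σ_{k ∈ [α₀−R, α₀+R−1]} ‖Δ k‖² + 2R'·(3·(196F₀·D·3(R−R'+1)⁻²)² + 3·(441F₀‖g‖₁)²)` —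
uniformly in `ϱ` (the band width never enters).  No harmonicity is used. [this file, g58] -/
theorem flux_sq_sum_le (hc : 0 < c) (hL : IsLayeredCrystal c a b w) (ϱ : ℝ) (g : Fin 2 → E3) (cf : ℤ → E3) {D : ℝ}
    (hD : ∀ k : ℤ, ‖cf (k + 1) - cf k‖ ≤ D) (α₀ : ℤ) (R R' : ℕ) :
    ∑ m ∈ Icc (α₀ - R') (α₀ + R' - 1), ‖columnFlux ϱ a b w ⌊ϱ / c⌋₊ g cf m‖ ^ 2 ≤
      27 * (196 * kernelConst c) ^ 2 * (∑ k ∈ Icc (α₀ - R) (α₀ + R - 1), ‖cf (k + 1) - cf k‖ ^ 2) +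
        ((2 * R' : ℕ) : ℝ) * (3 * (196 * kernelConst c * D * (3 * ((((R - R' : ℕ) : ℝ) + 1)⁻¹) ^ 2)) ^ 2 +
          3 * (441 * kernelConst c * (‖g 0‖ + ‖g 1‖)) ^ 2) := by
  have hF := kernelConst_nonneg hc
  have hD0 : 0 ≤ D := (norm_nonneg _).trans (hD 0)
  have hper : ∀ m ∈ Icc (α₀ - (R' : ℤ)) (α₀ + R' - 1), ‖columnFlux ϱ a b w ⌊ϱ / c⌋₊ g cf m‖ ^ 2 ≤
      3 * ((196 * kernelConst c) ^ 2 * (3 * ∑ k ∈ Icc (α₀ - (R : ℤ)) (α₀ + R - 1), bandWt m k * ‖cf (k + 1) - cf k‖ ^ 2)) +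
        (3 * (196 * kernelConst c * D * (3 * ((((R - R' : ℕ) : ℝ) + 1)⁻¹) ^ 2)) ^ 2 + 3 * (441 * kernelConst c * (‖g 0‖ + ‖g 1‖)) ^ 2) := by
    intro m hm
    have h := norm_columnFlux_sq_le hc hL ϱ g cf m (Icc (α₀ - (R : ℤ)) (α₀ + R - 1)) hD
    have hfar : ∑ k ∈ Icc (m - (⌊ϱ / c⌋₊ : ℤ)) (m + ⌊ϱ / c⌋₊) with k ∉ Icc (α₀ - (R : ℤ)) (α₀ + R - 1), bandWt m k ≤
        3 * ((((R - R' : ℕ) : ℝ) + 1)⁻¹) ^ 2 :=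
      sum_bandWt_le_far _ m fun k hk => far_of_inner_gap hm (mem_filter.mp hk).2
    have hW0 : 0 ≤ ∑ k ∈ Icc (m - (⌊ϱ / c⌋₊ : ℤ)) (m + ⌊ϱ / c⌋₊) with k ∉ Icc (α₀ - (R : ℤ)) (α₀ + R - 1), bandWt m k :=
      sum_nonneg fun k _ => bandWt_nonneg m k
    have h2 : (196 * kernelConst c * D * ∑ k ∈ Icc (m - (⌊ϱ / c⌋₊ : ℤ)) (m + ⌊ϱ / c⌋₊) with k ∉ Icc (α₀ - (R : ℤ)) (α₀ + R - 1), bandWt m k) ^ 2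
        ≤ (196 * kernelConst c * D * (3 * ((((R - R' : ℕ) : ℝ) + 1)⁻¹) ^ 2)) ^ 2 :=
      pow_le_pow_left₀ (by positivity) (mul_le_mul_of_nonneg_left hfar (by positivity)) 2
    linarith
  refine (sum_le_sum hper).trans ?_
  rw [sum_add_distrib, sum_const, nsmul_eq_mul, Int.card_Icc]
  have hcard : ((α₀ + (R' : ℤ) - 1 + 1 - (α₀ - R')).toNat : ℝ) = ((2 * R' : ℕ) : ℝ) := by
    have h : (α₀ + (R' : ℤ) - 1 + 1 - (α₀ - R')).toNat = 2 * R' := by omega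
    rw [h]
  rw [hcard]
  have hx := sum_sum_bandWt_mul_le (Icc (α₀ - (R' : ℤ)) (α₀ + R' - 1)) (Icc (α₀ - (R : ℤ)) (α₀ + R - 1))
    (x := fun k => ‖cf (k + 1) - cf k‖ ^ 2) fun k => sq_nonneg _
  have h1 : ∑ m ∈ Icc (α₀ - (R' : ℤ)) (α₀ + R' - 1),
      3 * ((196 * kernelConst c) ^ 2 * (3 * ∑ k ∈ Icc (α₀ - (R : ℤ)) (α₀ + R - 1), bandWt m k * ‖cf (k + 1) - cf k‖ ^ 2)) =
      9 * (196 * kernelConst c) ^ 2 *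
        ∑ m ∈ Icc (α₀ - (R' : ℤ)) (α₀ + R' - 1), ∑ k ∈ Icc (α₀ - (R : ℤ)) (α₀ + R - 1), bandWt m k * ‖cf (k + 1) - cf k‖ ^ 2 := by
    rw [mul_sum]
    exact sum_congr rfl fun m _ => by ring
  rw [h1]
  have hF2 : 0 ≤ 9 * (196 * kernelConst c) ^ 2 := by positivity
  nlinarith [mul_le_mul_of_nonneg_left hx hF2]

/-- THE INNER-GAP FLUX BOUND — statement shape (g58): `flux_sq_sum_le` for every layered crystal, range `ϱ`, mode field `(g, cf)` with increments
bounded by `D`, centre layer `α₀` and radii `R, R'`. [this file, g58] -/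
def InnerFluxShape : Prop :=
  ∀ (c : ℝ) (a b : E3) (w : ℤ → E3), 0 < c → IsLayeredCrystal c a b w → ∀ (ϱ : ℝ) (g : Fin 2 → E3) (cf : ℤ → E3) (D : ℝ),
    (∀ k : ℤ, ‖cf (k + 1) - cf k‖ ≤ D) → ∀ (α₀ : ℤ) (R R' : ℕ),
      ∑ m ∈ Icc (α₀ - R') (α₀ + R' - 1), ‖columnFlux ϱ a b w ⌊ϱ / c⌋₊ g cf m‖ ^ 2 ≤
        27 * (196 * kernelConst c) ^ 2 * (∑ k ∈ Icc (α₀ - R) (α₀ + R - 1), ‖cf (k + 1) - cf k‖ ^ 2) +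
          ((2 * R' : ℕ) : ℝ) * (3 * (196 * kernelConst c * D * (3 * ((((R - R' : ℕ) : ℝ) + 1)⁻¹) ^ 2)) ^ 2 +
            3 * (441 * kernelConst c * (‖g 0‖ + ‖g 1‖)) ^ 2)

/-- ★ the inner-gap flux bound holds. [this file, g58] -/
theorem innerFluxShape_holds : InnerFluxShape :=
  fun _ _ _ _ hc hL ϱ g cf _ hD α₀ R R' => flux_sq_sum_le hc hL ϱ g cf hD α₀ R R'

end FluxEnergy

end Summit.AtomisticToContinuum.Crystallization.Theorems.ChartedZeroExcessLayeredLatticeLiouville
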